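import Summits.Langlands.Langlands.Theorems.PhantomRMYoshidaResiduallyYoshidaLiftingSplit
import HarnessLib

/-!
# Route `PhantomRMYoshida`, crux `ResiduallyYoshidaLifting` (stmt-Langlands-13639): glue of the
# RELATIVE (anchored) sector split
# (`RelKlingenDensityGeneric` / `KlingenLimitClassicality` / `RelKlingenDensityCorner`)

Crux strategist planner-cstrat-stmt-Langlands-13639-s1-0 (2026-08-17), `--supports stmt-Langlands-13639`.

The prepared route-level split of the first strategist (p1, `Cruxes/ResiduallyYoshidaLifting/STRATEGY-CENSUS.md`
§6, glue p137929 `SectorSplit.ResiduallyYoshidaLifting_of_subs`) cuts the Klingen density layer KL1 by residual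
sector but makes both density children ABSOLUTE: `KlingenDensityGeneric` / `KlingenDensityCorner` carry no
automorphic anchor, so their conjunction with KL2 is the whole route TARGET `PhantomRMSector`
(`phantomRMSector_iff_subs`), strictly more than the crux, and on anchor-less fibres they re-internalise the
burden of the route's OTHER crux `StableYoshidaCongruence` (existence of a stable automorphic point).  The two
engines in which the crux's relative datum `ρ₀` has teeth — the Khare–Thorne cross-prime scheme (line C: its
level-raising SEED is `ρ₀`) and Berger–Klosin principality on the cyclic sub-sector (the anchor of the unique
realised class is `ρ₀`) — cannot even be stated on the absolute children.

This file types the ANCHORED form of the two density children and proves the glue (pure logic, sorry-free):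

* `RelKlingenDensityGeneric` — on a generic fibre CARRYING an irreducible automorphic `Sh`-point `ρ₀`, every
  irreducible `Sh`-point `ρ` is a Klingen classical limit (binders: those of the crux, in the landed vocabulary
  `DetC` / `Sh` / `Aut` / `GenericSector` / `IsKlingenClassicalLimit`);
* `RelKlingenDensityCorner` — the same off the generic sector;
* **`ResiduallyYoshidaLifting_of_relSubs :
    RelKlingenDensityGeneric → KlingenLimitClassicality → RelKlingenDensityCorner → ResiduallyYoshidaLifting`**
  (the `--glue-by` declaration of the relative split; classical case split on the sector, then KL2);
* the absolute children imply the relative ones (`relKlingenDensityGeneric_of_abs`, `…Corner_of_abs`), so every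
  absolute line (the live skeleton `Lines/sector_klingen_split.lean`) proves the relative children a fortiori;
* the crux implies both relative density children (`relKlingenDensityGeneric_of_crux`, `…Corner_of_crux`:
  an automorphic `Sh`-point is its own Klingen approximant, p116982), hence the EXACTNESS statement
  `relSubs_iff : (RelKDG ∧ KL2 ∧ RelKDC) ↔ (ResiduallyYoshidaLifting ∧ KlingenLimitClassicality)` —
  the relative split exceeds the crux by KL2 only (KL2 ≤ target, p116982), whereas the absolute split
  exceeds it by the whole target;
* the route target implies all three relative children (no risk beyond conjunct (B)).

What is NOT claimed: none of the three children is proved; all are open in print at a residually split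
Yoshida maximal ideal (census).  The two `Rel…` statements are OPEN statements of this crux (conjecture-grade,
implied by the crux itself); like KL1/KL2 they deliberately carry no citation tag and must not be relocated to
`Literature/`.
-/

noncomputable section

-- `Summit.Langlands.Langlands.…` (summit = sub-problem name, D-0017 layout) trips `dupNamespace` on every decl.
set_option linter.dupNamespace false
set_option autoImplicit false

open IsDedekindDomain Filter
open Literature.NumberTheory.GaloisRepresentations Literature.NumberTheory.Automorphic
open Summit.Langlands.Langlands.Cruxes.ResiduallyYoshidaLifting.YoshidaDivisorSelmerCount
open Summit.Langlands.Langlands.Cruxes.ResiduallyYoshidaLifting.SectorSplit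

namespace Summit.Langlands.Langlands.Cruxes.ResiduallyYoshidaLifting.RelSectorSplit

/-! ## The two ANCHORED density statements (OPEN; the intended relative sub-cruxes 1 and 3) -/

/-- **`RelKlingenDensityGeneric` — anchored Klingen density on the generic sector** (intended relative
sub-crux 1, the open core of the crux): on an admissible residual fibre (`σ̄, σ̄'` irreducible, non-conjugate,
`det σ̄ = det σ̄' = ε̄⁻¹`) in the GENERIC sector which carries an irreducible AUTOMORPHIC `Sh`-point `ρ₀`, every
irreducible `ρ` with `Sh ρ` is a Klingen classical limit.  Binders = those of the crux (`ρ₀ ρ`), vocabulary of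
p116982/p137929.  Implied by the crux (`relKlingenDensityGeneric_of_crux`) and by the absolute child
(`relKlingenDensityGeneric_of_abs`)
(open statement of this crux; deliberately no citation tag, must not be relocated to Literature/). -/
def RelKlingenDensityGeneric : Prop :=
  ∀ (p : ℕ) [Fact p.Prime], p ≠ 2 → ∀ (k : Type) [Field k] [CharP k p] [IsAlgClosed k]
    [TopologicalSpace k] [DiscreteTopology k] (red : Valued.integer (PadicAlgCl p) →+* k)
    (σ σ' : FramedGaloisRep ℚ k 2) (hcpt : isCompact_glFiniteIntegralLevel 4 ℚ) (ι : PadicAlgCl p ≃+* ℂ)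
    (ρ₀ ρ : FramedGaloisRep ℚ (PadicAlgCl p) 4),
    σ.toGaloisRep.IsIrreducible → σ'.toGaloisRep.IsIrreducible → DetC p k σ σ' →
    (¬ ∃ g : GL (Fin 2) k, ∀ x, g * σ x * g⁻¹ = σ' x) → GenericSector p k σ σ' →
    ρ₀.toGaloisRep.IsIrreducible → Sh p k red σ σ' ρ₀ → Aut p hcpt ι ρ₀ →
    ρ.toGaloisRep.IsIrreducible → Sh p k red σ σ' ρ → IsKlingenClassicalLimit p hcpt ι ρ

/-- **`RelKlingenDensityCorner` — anchored Klingen density off the generic sector** (intended relative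
sub-crux 3; the named residue of conjunct (B): by p146293 the corner of an `Sh`-fibre is `p = 3` or a twist
pair): same as `RelKlingenDensityGeneric` under `¬ GenericSector p k σ σ'`
(open statement of this crux; deliberately no citation tag, must not be relocated to Literature/). -/
def RelKlingenDensityCorner : Prop :=
  ∀ (p : ℕ) [Fact p.Prime], p ≠ 2 → ∀ (k : Type) [Field k] [CharP k p] [IsAlgClosed k]
    [TopologicalSpace k] [DiscreteTopology k] (red : Valued.integer (PadicAlgCl p) →+* k)
    (σ σ' : FramedGaloisRep ℚ k 2) (hcpt : isCompact_glFiniteIntegralLevel 4 ℚ) (ι : PadicAlgCl p ≃+* ℂ)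
    (ρ₀ ρ : FramedGaloisRep ℚ (PadicAlgCl p) 4),
    σ.toGaloisRep.IsIrreducible → σ'.toGaloisRep.IsIrreducible → DetC p k σ σ' →
    (¬ ∃ g : GL (Fin 2) k, ∀ x, g * σ x * g⁻¹ = σ' x) → ¬ GenericSector p k σ σ' →
    ρ₀.toGaloisRep.IsIrreducible → Sh p k red σ σ' ρ₀ → Aut p hcpt ι ρ₀ →
    ρ.toGaloisRep.IsIrreducible → Sh p k red σ σ' ρ → IsKlingenClassicalLimit p hcpt ι ρ

/-! ## Glue: the crux from the three relative sub-cruxes -/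

/-- **`ResiduallyYoshidaLifting_of_relSubs`** — the glue under its route-level name (the `--glue-by`
declaration of the relative split): relative generic density → limit classicality (KL2, p116982) → relative
corner density → the crux.  Pure logic: classical case split on `GenericSector p k σ σ'`, the anchor `ρ₀` of
the crux is handed to the density child, KL2 turns the Klingen limit into automorphy. -/
theorem ResiduallyYoshidaLifting_of_relSubs :
    RelKlingenDensityGeneric → KlingenLimitClassicality → RelKlingenDensityCorner →
      Summit.Langlands.Langlands.Theses.PhantomRMYoshida.ResiduallyYoshidaLifting := by
  intro h₁ h₂ h₃ p _ hp k _ _ _ _ _ red σ σ' hcpt ι ρ₀ ρ _εb _Aut _Sh _ _ hσ hσ' hdet hnc hρ₀ hSh₀ hA₀ hρ hSh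
  by_cases hG : GenericSector p k σ σ'
  · exact h₂ p hp k red σ σ' hcpt ι ρ hσ hσ' hdet hnc hρ hSh
      (h₁ p hp k red σ σ' hcpt ι ρ₀ ρ hσ hσ' hdet hnc hG hρ₀ hSh₀ hA₀ hρ hSh)
  · exact h₂ p hp k red σ σ' hcpt ι ρ hσ hσ' hdet hnc hρ hSh
      (h₃ p hp k red σ σ' hcpt ι ρ₀ ρ hσ hσ' hdet hnc hG hρ₀ hSh₀ hA₀ hρ hSh)

/-- Registered-stub-shaped alias of the glue (`stub_relSectorSplit`). -/
theorem stub_relSectorSplit :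
    RelKlingenDensityGeneric → KlingenLimitClassicality → RelKlingenDensityCorner →
      Summit.Langlands.Langlands.Theses.PhantomRMYoshida.ResiduallyYoshidaLifting :=
  ResiduallyYoshidaLifting_of_relSubs

/-! ## Absolute ⟹ relative: every absolute line proves the relative children a fortiori -/

/-- `KlingenDensityGeneric → RelKlingenDensityGeneric` (drop the anchor). -/
theorem relKlingenDensityGeneric_of_abs (h : KlingenDensityGeneric) : RelKlingenDensityGeneric :=
  fun p _ hp k _ _ _ _ _ red σ σ' hcpt ι _ρ₀ ρ hσ hσ' hdet hnc hG _ _ _ hρ hSh =>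
    h p hp k red σ σ' hcpt ι ρ hσ hσ' hdet hnc hG hρ hSh

/-- `KlingenDensityCorner → RelKlingenDensityCorner` (drop the anchor). -/
theorem relKlingenDensityCorner_of_abs (h : KlingenDensityCorner) : RelKlingenDensityCorner :=
  fun p _ hp k _ _ _ _ _ red σ σ' hcpt ι _ρ₀ ρ hσ hσ' hdet hnc hG _ _ _ hρ hSh =>
    h p hp k red σ σ' hcpt ι ρ hσ hσ' hdet hnc hG hρ hSh

/-! ## The crux ⟹ both relative density children: the relative split is crux-faithful -/

/-- **crux ⟹ relative sub-crux 1**: under `ResiduallyYoshidaLifting`, `ρ` is automorphic (oddness from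
`DetC`, the anchor `ρ₀` is available), hence its own Klingen approximant (`isKlingenClassicalLimit_of_aut`,
p116982). -/
theorem relKlingenDensityGeneric_of_crux
    (h : Summit.Langlands.Langlands.Theses.PhantomRMYoshida.ResiduallyYoshidaLifting) :
    RelKlingenDensityGeneric := by
  intro p _ hp k _ _ _ _ _ red σ σ' hcpt ι ρ₀ ρ hσ hσ' hdet hnc _hG hρ₀ hSh₀ hA₀ hρ hSh
  exact isKlingenClassicalLimit_of_aut hSh
    (h p hp k red σ σ' hcpt ι ρ₀ ρ (isOdd_of_detC hdet).1 (isOdd_of_detC hdet).2 hσ hσ' hdet hnc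
      hρ₀ hSh₀ hA₀ hρ hSh)

/-- **crux ⟹ relative sub-crux 3** (same proof off the generic sector). -/
theorem relKlingenDensityCorner_of_crux
    (h : Summit.Langlands.Langlands.Theses.PhantomRMYoshida.ResiduallyYoshidaLifting) :
    RelKlingenDensityCorner := by
  intro p _ hp k _ _ _ _ _ red σ σ' hcpt ι ρ₀ ρ hσ hσ' hdet hnc _hG hρ₀ hSh₀ hA₀ hρ hSh
  exact isKlingenClassicalLimit_of_aut hSh
    (h p hp k red σ σ' hcpt ι ρ₀ ρ (isOdd_of_detC hdet).1 (isOdd_of_detC hdet).2 hσ hσ' hdet hnc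
      hρ₀ hSh₀ hA₀ hρ hSh)

/-- **EXACTNESS of the relative split w.r.t. the crux**: the three relative children are equivalent to the
crux together with KL2 — the relative split exceeds the crux ONLY by `KlingenLimitClassicality` (which is
`≤` the route target, `klingenLimitClassicality_of_phantomRMSector`, p116982).  Contrast: the absolute split
is equivalent to the whole route target (`phantomRMSector_iff_subs`, p137929). -/
theorem relSubs_iff :
    (RelKlingenDensityGeneric ∧ KlingenLimitClassicality ∧ RelKlingenDensityCorner) ↔
      (Summit.Langlands.Langlands.Theses.PhantomRMYoshida.ResiduallyYoshidaLifting ∧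
        KlingenLimitClassicality) :=
  ⟨fun h => ⟨ResiduallyYoshidaLifting_of_relSubs h.1 h.2.1 h.2.2, h.2.1⟩,
    fun h => ⟨relKlingenDensityGeneric_of_crux h.1, h.2, relKlingenDensityCorner_of_crux h.1⟩⟩

/-! ## The route target ⟹ all three relative children (no risk beyond conjunct (B)) -/

/-- target ⟹ relative sub-crux 1. -/
theorem relKlingenDensityGeneric_of_phantomRMSector
    (h : Summit.Langlands.Langlands.Theses.PhantomRMYoshida.PhantomRMSector) :
    RelKlingenDensityGeneric :=
  relKlingenDensityGeneric_of_abs (klingenDensityGeneric_of_phantomRMSector h)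

/-- target ⟹ relative sub-crux 3. -/
theorem relKlingenDensityCorner_of_phantomRMSector
    (h : Summit.Langlands.Langlands.Theses.PhantomRMYoshida.PhantomRMSector) :
    RelKlingenDensityCorner :=
  relKlingenDensityCorner_of_abs (klingenDensityCorner_of_phantomRMSector h)

/-- target ⟹ the three relative children together (KL2 by `klingenLimitClassicality_of_phantomRMSector`). -/
theorem relSubs_of_phantomRMSector
    (h : Summit.Langlands.Langlands.Theses.PhantomRMYoshida.PhantomRMSector) :
    RelKlingenDensityGeneric ∧ KlingenLimitClassicality ∧ RelKlingenDensityCorner :=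
  ⟨relKlingenDensityGeneric_of_phantomRMSector h, klingenLimitClassicality_of_phantomRMSector h,
    relKlingenDensityCorner_of_phantomRMSector h⟩

end Summit.Langlands.Langlands.Cruxes.ResiduallyYoshidaLifting.RelSectorSplit


/-! ## s1 SPLIT CHECK: the INLINE route-cone children (as `route edit --split` renders them) are
definitionally the Theorems-side statements, and the generated glue is provable from
`ResiduallyYoshidaLifting_of_relSubs` verbatim. -/

namespace Summit.Langlands.Langlands.Theses.PhantomRMYoshida

open Literature.NumberTheory.GaloisRepresentations Literature.NumberTheory.Automorphic IsDedekindDomain NumberField in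
/-- inline child RelKlingenDensityGeneric (cone check) -/
def RelKlingenDensityGeneric : Prop :=
  ∀ (p : ℕ) [Fact p.Prime], p ≠ 2 → ∀ (k : Type) [Field k] [CharP k p] [IsAlgClosed k] [TopologicalSpace k] [DiscreteTopology k] (red : Valued.integer (PadicAlgCl p) →+* k) (σ σ' : FramedGaloisRep ℚ k 2) (hcpt : isCompact_glFiniteIntegralLevel 4 ℚ) (ι : PadicAlgCl p ≃+* ℂ) (ρ₀ ρ : FramedGaloisRep ℚ (PadicAlgCl p) 4), let εb : Field.absoluteGaloisGroup ℚ →* (ZMod p)ˣ := (modularCyclotomicCharacter (AlgebraicClosure ℚ) (HasEnoughRootsOfUnity.natCard_rootsOfUnity (AlgebraicClosure ℚ) p)).comp (MulSemiringAction.toRingAut (Field.absoluteGaloisGroup ℚ) (AlgebraicClosure ℚ)); let Aut := fun r : FramedGaloisRep ℚ (PadicAlgCl p) 4 => (∃ π : CuspidalAutomorphicRepData 4 ℚ hcpt, π.1.IsLAlgebraic ∧ ∀ᶠ v : HeightOneSpectrum (RingOfIntegers ℚ) in Filter.cofinite, ∃ a : Multiset ℂ, π.1.HasSatakeParamAt v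 a ∧ r.IsUnramifiedAt v ∧ r.HasFrobCharpolyAt v (arithFrobPolyOfSatake ι v.residueCard 1 a)); let Sh := fun r : FramedGaloisRep ℚ (PadicAlgCl p) 4 => (r.IsSymplecticWithMultiplierFun (fun g => algebraMap ℚ_[p] (PadicAlgCl p) ((((GaloisRep.cyclotomicCharacter ℚ p g)⁻¹ : ℤ_[p]ˣ) : ℤ_[p]) : ℚ_[p])) ∧ (∀ v : HeightOneSpectrum (RingOfIntegers ℚ), ((p : ℕ) : RingOfIntegers ℚ) ∈ v.asIdeal → r.IsGreenbergOrdinaryOfShapeAt v ![0, 0, 1, 1] ∧ r.IsResiduallyDistinguishedAt v ![0, 0, 1, 1]) ∧ (∀ᶠ v : HeightOneSpectrum (RingOfIntegers ℚ) in Filter.cofinite, r.IsUnramifiedAt v ∧ σ.IsUnramifiedAt v ∧ σ'.IsUnramifiedAt v ∧ ∃ (P : Polynomial (Valued.integer (PadicAlgCl p))) (P₁ P₂ : Polynomial k), r.HasFrobCharpolyAt v (P.map (Valued.integer (PadicAlgCl p)).subtype) ∧ σ.HasFrobCharpolyAt v P₁ ∧ σ'.HasFrobCharpolyAt v P₂ ∧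 P.map red = P₁ * P₂)); let KLim := fun r : FramedGaloisRep ℚ (PadicAlgCl p) 4 => (∃ S : Set (HeightOneSpectrum (RingOfIntegers ℚ)), S.Finite ∧ ∀ n : ℕ, ∃ (r' : FramedGaloisRep ℚ (PadicAlgCl p) 4) (c : ℕ), Aut r' ∧ (c : ZMod ((p - 1) * p ^ n)) = 1 ∧ (∃ ν : Field.absoluteGaloisGroup ℚ → PadicAlgCl p, r'.IsSymplecticWithMultiplierFun ν) ∧ (∀ v : HeightOneSpectrum (RingOfIntegers ℚ), ((p : ℕ) : RingOfIntegers ℚ) ∈ v.asIdeal → r'.IsGreenbergOrdinaryOfShapeAt v ![0, 0, c, c] ∧ r'.IsResiduallyDistinguishedAt v ![0, 0, c, c]) ∧ ∀ v ∉ S, r.IsUnramifiedAt v ∧ r'.IsUnramifiedAt v ∧ ∃ P P' : Polynomial (Valued.integer (PadicAlgCl p)), r.HasFrobCharpolyAt v (P.map (Valued.integer (PadicAlgCl p)).subtype) ∧ r'.HasFrobCharpolyAt v (P'.map (Valued.integer (PadicAlgCl p)).subtype) ∧ ∀ i : ℕ, ‖((P.coeff i : Valued.integer (PadicAlgCl p))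 : PadicAlgCl p) - ((P'.coeff i : Valued.integer (PadicAlgCl p)) : PadicAlgCl p)‖ ≤ ‖(p : PadicAlgCl p)‖ ^ n); let Gen : Prop := (5 ≤ p ∧ FramedRep.IsAbsolutelyIrreducible (FramedGaloisRep.restrictField (CyclotomicField p ℚ) σ) ∧ FramedRep.IsAbsolutelyIrreducible (FramedGaloisRep.restrictField (CyclotomicField p ℚ) σ') ∧ ¬ ∃ g : GL (Fin 2) k, ∀ x, ∃ c : k, (g * σ x * g⁻¹).val = c • (σ' x).val); σ.toGaloisRep.IsIrreducible → σ'.toGaloisRep.IsIrreducible → (∀ g, FramedRep.det σ g = (Units.map (ZMod.castHom (dvd_refl p) k).toMonoidHom (εb g))⁻¹ ∧ FramedRep.det σ' g = FramedRep.det σ g) → (¬ ∃ g : GL (Fin 2) k, ∀ x, g * σ x * g⁻¹ = σ' x) → Gen → ρ₀.toGaloisRep.IsIrreducible → Sh ρ₀ → Aut ρ₀ → ρ.toGaloisRep.IsIrreducible → Sh ρ → KLim ρ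

open Literature.NumberTheory.GaloisRepresentations Literature.NumberTheory.Automorphic IsDedekindDomain NumberField in
/-- inline child KlingenLimitClassicality (cone check) -/
def KlingenLimitClassicality : Prop :=
  ∀ (p : ℕ) [Fact p.Prime], p ≠ 2 → ∀ (k : Type) [Field k] [CharP k p] [IsAlgClosed k] [TopologicalSpace k] [DiscreteTopology k] (red : Valued.integer (PadicAlgCl p) →+* k) (σ σ' : FramedGaloisRep ℚ k 2) (hcpt : isCompact_glFiniteIntegralLevel 4 ℚ) (ι : PadicAlgCl p ≃+* ℂ) (ρ : FramedGaloisRep ℚ (PadicAlgCl p) 4), let εb : Field.absoluteGaloisGroup ℚ →* (ZMod p)ˣ := (modularCyclotomicCharacter (AlgebraicClosure ℚ) (HasEnoughRootsOfUnity.natCard_rootsOfUnity (AlgebraicClosure ℚ) p)).comp (MulSemiringAction.toRingAut (Field.absoluteGaloisGroup ℚ) (AlgebraicClosure ℚ)); let Aut := fun r : FramedGaloisRep ℚ (PadicAlgCl p) 4 => (∃ π : CuspidalAutomorphicRepData 4 ℚ hcpt, π.1.IsLAlgebraic ∧ ∀ᶠ v : HeightOneSpectrum (RingOfIntegers ℚ)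 in Filter.cofinite, ∃ a : Multiset ℂ, π.1.HasSatakeParamAt v a ∧ r.IsUnramifiedAt v ∧ r.HasFrobCharpolyAt v (arithFrobPolyOfSatake ι v.residueCard 1 a)); let Sh := fun r : FramedGaloisRep ℚ (PadicAlgCl p) 4 => (r.IsSymplecticWithMultiplierFun (fun g => algebraMap ℚ_[p] (PadicAlgCl p) ((((GaloisRep.cyclotomicCharacter ℚ p g)⁻¹ : ℤ_[p]ˣ) : ℤ_[p]) : ℚ_[p])) ∧ (∀ v : HeightOneSpectrum (RingOfIntegers ℚ), ((p : ℕ) : RingOfIntegers ℚ) ∈ v.asIdeal → r.IsGreenbergOrdinaryOfShapeAt v ![0, 0, 1, 1] ∧ r.IsResiduallyDistinguishedAt v ![0, 0, 1, 1]) ∧ (∀ᶠ v : HeightOneSpectrum (RingOfIntegers ℚ) in Filter.cofinite, r.IsUnramifiedAt v ∧ σ.IsUnramifiedAt v ∧ σ'.IsUnramifiedAt v ∧ ∃ (P : Polynomial (Valued.integer (PadicAlgCl p))) (P₁ P₂ : Polynomial k), r.HasFrobCharpolyAt v (P.map (Valued.integer (PadicAlgCl p)).subtype) ∧ σ.HasFrobCharpolyAt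 v P₁ ∧ σ'.HasFrobCharpolyAt v P₂ ∧ P.map red = P₁ * P₂)); let KLim := fun r : FramedGaloisRep ℚ (PadicAlgCl p) 4 => (∃ S : Set (HeightOneSpectrum (RingOfIntegers ℚ)), S.Finite ∧ ∀ n : ℕ, ∃ (r' : FramedGaloisRep ℚ (PadicAlgCl p) 4) (c : ℕ), Aut r' ∧ (c : ZMod ((p - 1) * p ^ n)) = 1 ∧ (∃ ν : Field.absoluteGaloisGroup ℚ → PadicAlgCl p, r'.IsSymplecticWithMultiplierFun ν) ∧ (∀ v : HeightOneSpectrum (RingOfIntegers ℚ), ((p : ℕ) : RingOfIntegers ℚ) ∈ v.asIdeal → r'.IsGreenbergOrdinaryOfShapeAt v ![0, 0, c, c] ∧ r'.IsResiduallyDistinguishedAt v ![0, 0, c, c]) ∧ ∀ v ∉ S, r.IsUnramifiedAt v ∧ r'.IsUnramifiedAt v ∧ ∃ P P' : Polynomial (Valued.integer (PadicAlgCl p)), r.HasFrobCharpolyAt v (P.map (Valued.integer (PadicAlgCl p)).subtype) ∧ r'.HasFrobCharpolyAt v (P'.map (Valued.integer (PadicAlgCl p)).subtype) ∧ ∀ i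 : ℕ, ‖((P.coeff i : Valued.integer (PadicAlgCl p)) : PadicAlgCl p) - ((P'.coeff i : Valued.integer (PadicAlgCl p)) : PadicAlgCl p)‖ ≤ ‖(p : PadicAlgCl p)‖ ^ n); σ.toGaloisRep.IsIrreducible → σ'.toGaloisRep.IsIrreducible → (∀ g, FramedRep.det σ g = (Units.map (ZMod.castHom (dvd_refl p) k).toMonoidHom (εb g))⁻¹ ∧ FramedRep.det σ' g = FramedRep.det σ g) → (¬ ∃ g : GL (Fin 2) k, ∀ x, g * σ x * g⁻¹ = σ' x) → ρ.toGaloisRep.IsIrreducible → Sh ρ → KLim ρ → Aut ρ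

open Literature.NumberTheory.GaloisRepresentations Literature.NumberTheory.Automorphic IsDedekindDomain NumberField in
/-- inline child RelKlingenDensityCorner (cone check) -/
def RelKlingenDensityCorner : Prop :=
  ∀ (p : ℕ) [Fact p.Prime], p ≠ 2 → ∀ (k : Type) [Field k] [CharP k p] [IsAlgClosed k] [TopologicalSpace k] [DiscreteTopology k] (red : Valued.integer (PadicAlgCl p) →+* k) (σ σ' : FramedGaloisRep ℚ k 2) (hcpt : isCompact_glFiniteIntegralLevel 4 ℚ) (ι : PadicAlgCl p ≃+* ℂ) (ρ₀ ρ : FramedGaloisRep ℚ (PadicAlgCl p) 4), let εb : Field.absoluteGaloisGroup ℚ →* (ZMod p)ˣ := (modularCyclotomicCharacter (AlgebraicClosure ℚ) (HasEnoughRootsOfUnity.natCard_rootsOfUnity (AlgebraicClosure ℚ) p)).comp (MulSemiringAction.toRingAut (Field.absoluteGaloisGroup ℚ) (AlgebraicClosure ℚ)); let Aut := fun r : FramedGaloisRep ℚ (PadicAlgCl p) 4 => (∃ π : CuspidalAutomorphicRepData 4 ℚ hcpt, π.1.IsLAlgebraic ∧ ∀ᶠ v : HeightOneSpectrum (RingOfIntegers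 ℚ) in Filter.cofinite, ∃ a : Multiset ℂ, π.1.HasSatakeParamAt v a ∧ r.IsUnramifiedAt v ∧ r.HasFrobCharpolyAt v (arithFrobPolyOfSatake ι v.residueCard 1 a)); let Sh := fun r : FramedGaloisRep ℚ (PadicAlgCl p) 4 => (r.IsSymplecticWithMultiplierFun (fun g => algebraMap ℚ_[p] (PadicAlgCl p) ((((GaloisRep.cyclotomicCharacter ℚ p g)⁻¹ : ℤ_[p]ˣ) : ℤ_[p]) : ℚ_[p])) ∧ (∀ v : HeightOneSpectrum (RingOfIntegers ℚ), ((p : ℕ) : RingOfIntegers ℚ) ∈ v.asIdeal → r.IsGreenbergOrdinaryOfShapeAt v ![0, 0, 1, 1] ∧ r.IsResiduallyDistinguishedAt v ![0, 0, 1, 1]) ∧ (∀ᶠ v : HeightOneSpectrum (RingOfIntegers ℚ) in Filter.cofinite, r.IsUnramifiedAt v ∧ σ.IsUnramifiedAt v ∧ σ'.IsUnramifiedAt v ∧ ∃ (P : Polynomial (Valued.integer (PadicAlgCl p))) (P₁ P₂ : Polynomial k), r.HasFrobCharpolyAt v (P.map (Valued.integer (PadicAlgCl p)).subtype) ∧ σ.HasFrobCharpolyAt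 v P₁ ∧ σ'.HasFrobCharpolyAt v P₂ ∧ P.map red = P₁ * P₂)); let KLim := fun r : FramedGaloisRep ℚ (PadicAlgCl p) 4 => (∃ S : Set (HeightOneSpectrum (RingOfIntegers ℚ)), S.Finite ∧ ∀ n : ℕ, ∃ (r' : FramedGaloisRep ℚ (PadicAlgCl p) 4) (c : ℕ), Aut r' ∧ (c : ZMod ((p - 1) * p ^ n)) = 1 ∧ (∃ ν : Field.absoluteGaloisGroup ℚ → PadicAlgCl p, r'.IsSymplecticWithMultiplierFun ν) ∧ (∀ v : HeightOneSpectrum (RingOfIntegers ℚ), ((p : ℕ) : RingOfIntegers ℚ) ∈ v.asIdeal → r'.IsGreenbergOrdinaryOfShapeAt v ![0, 0, c, c] ∧ r'.IsResiduallyDistinguishedAt v ![0, 0, c, c]) ∧ ∀ v ∉ S, r.IsUnramifiedAt v ∧ r'.IsUnramifiedAt v ∧ ∃ P P' : Polynomial (Valued.integer (PadicAlgCl p)), r.HasFrobCharpolyAt v (P.map (Valued.integer (PadicAlgCl p)).subtype) ∧ r'.HasFrobCharpolyAt v (P'.map (Valued.integer (PadicAlgCl p)).subtype) ∧ ∀ i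 : ℕ, ‖((P.coeff i : Valued.integer (PadicAlgCl p)) : PadicAlgCl p) - ((P'.coeff i : Valued.integer (PadicAlgCl p)) : PadicAlgCl p)‖ ≤ ‖(p : PadicAlgCl p)‖ ^ n); let Gen : Prop := (5 ≤ p ∧ FramedRep.IsAbsolutelyIrreducible (FramedGaloisRep.restrictField (CyclotomicField p ℚ) σ) ∧ FramedRep.IsAbsolutelyIrreducible (FramedGaloisRep.restrictField (CyclotomicField p ℚ) σ') ∧ ¬ ∃ g : GL (Fin 2) k, ∀ x, ∃ c : k, (g * σ x * g⁻¹).val = c • (σ' x).val); σ.toGaloisRep.IsIrreducible → σ'.toGaloisRep.IsIrreducible → (∀ g, FramedRep.det σ g = (Units.map (ZMod.castHom (dvd_refl p) k).toMonoidHom (εb g))⁻¹ ∧ FramedRep.det σ' g = FramedRep.det σ g) → (¬ ∃ g : GL (Fin 2) k, ∀ x, g * σ x * g⁻¹ = σ' x) → ¬ Gen → ρ₀.toGaloisRep.IsIrreducible → Sh ρ₀ → Aut ρ₀ → ρ.toGaloisRep.IsIrreducible → Sh ρ → KLim ρ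

/-- the glue statement the gate will generate for `--glue` -/
def ResiduallyYoshidaLiftingOfRelSubs : Prop :=
  RelKlingenDensityGeneric → KlingenLimitClassicality → RelKlingenDensityCorner → ResiduallyYoshidaLifting

end Summit.Langlands.Langlands.Theses.PhantomRMYoshida


namespace Summit.Langlands.Langlands.Cruxes.ResiduallyYoshidaLifting.RelSectorSplit
open Summit.Langlands.Langlands.Theses.PhantomRMYoshida

example : Summit.Langlands.Langlands.Theses.PhantomRMYoshida.RelKlingenDensityGeneric ↔
    Summit.Langlands.Langlands.Cruxes.ResiduallyYoshidaLifting.RelSectorSplit.RelKlingenDensityGeneric := Iff.rfl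
example : Summit.Langlands.Langlands.Theses.PhantomRMYoshida.KlingenLimitClassicality ↔
    Summit.Langlands.Langlands.Cruxes.ResiduallyYoshidaLifting.YoshidaDivisorSelmerCount.KlingenLimitClassicality := Iff.rfl
example : Summit.Langlands.Langlands.Theses.PhantomRMYoshida.RelKlingenDensityCorner ↔
    Summit.Langlands.Langlands.Cruxes.ResiduallyYoshidaLifting.RelSectorSplit.RelKlingenDensityCorner := Iff.rfl
/-- the generated glue item, proved verbatim from the Theorems-side glue (prover: copy this line) -/
theorem generatedGlue_holds : Summit.Langlands.Langlands.Theses.PhantomRMYoshida.ResiduallyYoshidaLiftingOfRelSubs :=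
  fun h₁ h₂ h₃ => ResiduallyYoshidaLifting_of_relSubs h₁ h₂ h₃
/-- exactness restated on the inline children -/
example : (Summit.Langlands.Langlands.Theses.PhantomRMYoshida.RelKlingenDensityGeneric ∧
    Summit.Langlands.Langlands.Theses.PhantomRMYoshida.KlingenLimitClassicality ∧
    Summit.Langlands.Langlands.Theses.PhantomRMYoshida.RelKlingenDensityCorner) ↔
    (Summit.Langlands.Langlands.Theses.PhantomRMYoshida.ResiduallyYoshidaLifting ∧
      Summit.Langlands.Langlands.Cruxes.ResiduallyYoshidaLifting.YoshidaDivisorSelmerCount.KlingenLimitClassicality) :=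
  relSubs_iff

end Summit.Langlands.Langlands.Cruxes.ResiduallyYoshidaLifting.RelSectorSplit

end
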